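/-
Copyright (c) 2026 the pub-hodgecm-mathlib formalisation cell (harness21).  Prover seat hodgecm-mathlib-LH4-p07 (g9), req620 Track A «(D-RAM) FOUR-FRAME» squad
(STAGE-1b, row-(2) lineage; dealer LH4-plan (g13) WORD #58 RULING A ∕ #69 (4): owner of the two-literal census law of `lev_{a,m}`), 2026-09-04.
-/
import Summits.HodgeConjecture.HodgeConjecture.Theorems.F0P3cDyRamStageOneBDefs   -- ★ p859562 (dealer): `laLowOfRecord`, `laHighOfRecord`, `csOfRecord`, `klOfRecord`, `blOfRecord`, `mcOfRecord`, `sTOfRecord`; brings `mstarOfRecord`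
import HarnessLib

/-!
# Crux `H413`, line LH4 «(D-RAM) FOUR-FRAME» — STAGE-1b, row (2): (LAW-instances) «THE FIVE ROWS OF RECORD SATISFY THE LEVEL SOCKET'S GENERAL RULE»

Cell `hodgecm-mathlib` (D-0151), FLOOR 0, crux item H413 = `stmt-HodgeConjecture-24833`, route of record `HCCMUnconditional`; squad F0∕P3c∕LH4; lane
`--supports stmt-HodgeConjecture-24833 --as helper` (count-neutral; pays NO tier-0 row).  THEOREMS ONLY; pure `ℕ` bookkeeping (`omega` on the ★ schedule definitions).
OWNER'S ORGAN №16: the piece letters `had : a ≤ d`, `hab1 : d + 2a ≤ b + 1`, `hks : 2ks + 2((d + a%2)∕2) = a + a%2 + (b + b%2)`, `hT0 : a%2 = 0 → T + a = ks + (d − d%2)`,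
`hT1 : a%2 = 1 → T + a + 1 = ks + (d − d%2) + 2(d%2)` of ★ p860440 `levelsCensusB (a b ks T)` (and of its U∕RamM twins and LH4-p06 (g7)'s upper assembly), DISCHARGED at
the five rows of LAW-INSTANCES v1 with `T := (d − d%2) + bs`: sq `(0, m*, cs, cs)`, lev_lo `(ℓ₀, m*, cs, cs)`, lev_hi `(ℓ₀+1, m*, kl, bl)`, T₊-lo `(ℓ₀, m_c, sT, sT)`, T₊-hi
`(ℓ₀+1, m_c, sT+1, sT−1)` (`ℓ₀ = laLowOfRecord d`, `m* = mstarOfRecord d`, `m_c = mcOfRecord d`, schedules ★ p859562), every `d ≥ 2` — so the consumers close the socket's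
piece hypotheses by `exact (instanceLetters_… d hd).1` etc.
HONEST LABEL.  Count-neutral arithmetic; `HC_CM` is proved only modulo the 7 printed citations (2 remaining named inputs: hLiu418 = `stmt-HodgeConjecture-24832`,
h413 = `stmt-HodgeConjecture-24833`) until rung 0 closes.

## References
* [Rogawski1990] J. D. Rogawski, *Automorphic Representations of Unitary Groups in Three Variables*, Ann. of Math. Stud. 123 (1990): §4.9 Prop. 4.9.1 (b) p. 55 (the schedules of the
  level pieces whose constants these letters pin).
-/

set_option autoImplicit false

namespace Summit.HodgeConjecture.HodgeConjecture.Cruxes.H413.F0P3cDyRamLevelsLawInstanceLetters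

open Summit.HodgeConjecture.HodgeConjecture.Cruxes.H413.F0P3cDyRamFourFramePieces (mstarOfRecord)
open Summit.HodgeConjecture.HodgeConjecture.Cruxes.H413.F0P3cDyRamStageOneBDefs (laLowOfRecord laHighOfRecord csOfRecord klOfRecord blOfRecord mcOfRecord sTOfRecord)

/-- **ROW sq_{m*} = lev(0, m*)**: `(a, b, ks, T) = (0, mstarOfRecord d, csOfRecord d, (d − d%2) + csOfRecord d)`. [cite: Rogawski1990, §4.9 Prop. 4.9.1 (b) p. 55] -/
theorem instanceLetters_sq (d : ℕ) (hd : 2 ≤ d) :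
    0 ≤ d ∧ d + 2 * 0 ≤ mstarOfRecord d + 1 ∧
      2 * csOfRecord d + 2 * ((d + 0 % 2) / 2) = 0 + 0 % 2 + (mstarOfRecord d + mstarOfRecord d % 2) ∧
      (0 % 2 = 0 → (d - d % 2) + csOfRecord d + 0 = csOfRecord d + (d - d % 2)) ∧
      (0 % 2 = 1 → (d - d % 2) + csOfRecord d + 0 + 1 = csOfRecord d + (d - d % 2) + 2 * (d % 2)) := by
  have hms : mstarOfRecord d = d % 2 + 2 * d - 1 := rfl
  have hcs : csOfRecord d = (d + 1) / 2 := rfl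
  refine ⟨by omega, by omega, ?_, fun _ => by omega, fun h => by omega⟩
  rcases Nat.mod_two_eq_zero_or_one d with h | h <;> simp only [Nat.zero_mod, add_zero] <;> omega

/-- **ROW lev_lo = lev(ℓ₀, m*)**: `(laLowOfRecord d, mstarOfRecord d, csOfRecord d, (d − d%2) + csOfRecord d)`. [cite: Rogawski1990, §4.9 Prop. 4.9.1 (b) p. 55] -/
theorem instanceLetters_levLo (d : ℕ) (hd : 2 ≤ d) :
    laLowOfRecord d ≤ d ∧ d + 2 * laLowOfRecord d ≤ mstarOfRecord d + 1 ∧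
      2 * csOfRecord d + 2 * ((d + laLowOfRecord d % 2) / 2) = laLowOfRecord d + laLowOfRecord d % 2 + (mstarOfRecord d + mstarOfRecord d % 2) ∧
      (laLowOfRecord d % 2 = 0 → (d - d % 2) + csOfRecord d + laLowOfRecord d = csOfRecord d + (d - d % 2)) ∧
      (laLowOfRecord d % 2 = 1 → (d - d % 2) + csOfRecord d + laLowOfRecord d + 1 = csOfRecord d + (d - d % 2) + 2 * (d % 2)) := by
  have hms : mstarOfRecord d = d % 2 + 2 * d - 1 := rfl
  have hcs : csOfRecord d = (d + 1) / 2 := rfl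
  have hla : laLowOfRecord d = d % 2 := rfl
  refine ⟨by omega, by omega, by omega, fun h => by omega, fun h => by omega⟩

/-- **ROW lev_hi = lev(ℓ₀+1, m*)**: `(laHighOfRecord d, mstarOfRecord d, klOfRecord d, (d − d%2) + blOfRecord d)`. [cite: Rogawski1990, §4.9 Prop. 4.9.1 (b) p. 55] -/
theorem instanceLetters_levHi (d : ℕ) (hd : 2 ≤ d) :
    laHighOfRecord d ≤ d ∧ d + 2 * laHighOfRecord d ≤ mstarOfRecord d + 1 ∧
      2 * klOfRecord d + 2 * ((d + laHighOfRecord d % 2) / 2) = laHighOfRecord d + laHighOfRecord d % 2 + (mstarOfRecord d + mstarOfRecord d % 2) ∧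
      (laHighOfRecord d % 2 = 0 → (d - d % 2) + blOfRecord d + laHighOfRecord d = klOfRecord d + (d - d % 2)) ∧
      (laHighOfRecord d % 2 = 1 → (d - d % 2) + blOfRecord d + laHighOfRecord d + 1 = klOfRecord d + (d - d % 2) + 2 * (d % 2)) := by
  have hms : mstarOfRecord d = d % 2 + 2 * d - 1 := rfl
  have hkl : klOfRecord d = max (d % 2 + 1) d - d / 2 + 1 := rfl
  have hbl : blOfRecord d = klOfRecord d - 2 := rfl
  have hla : laHighOfRecord d = d % 2 + 1 := rfl
  have hmax : max (d % 2 + 1) d = d := max_eq_right (by omega)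
  rw [hmax] at hkl
  refine ⟨by omega, by omega, by omega, fun h => by omega, fun h => by omega⟩

/-- **ROW T₊-lo = lev(ℓ₀, m_c)**: `(laLowOfRecord d, mcOfRecord d, sTOfRecord d, (d − d%2) + sTOfRecord d)`. [cite: Rogawski1990, §4.9 Prop. 4.9.1 (b) p. 55] -/
theorem instanceLetters_levTLo (d : ℕ) (hd : 2 ≤ d) :
    laLowOfRecord d ≤ d ∧ d + 2 * laLowOfRecord d ≤ mcOfRecord d + 1 ∧
      2 * sTOfRecord d + 2 * ((d + laLowOfRecord d % 2) / 2) = laLowOfRecord d + laLowOfRecord d % 2 + (mcOfRecord d + mcOfRecord d % 2) ∧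
      (laLowOfRecord d % 2 = 0 → (d - d % 2) + sTOfRecord d + laLowOfRecord d = sTOfRecord d + (d - d % 2)) ∧
      (laLowOfRecord d % 2 = 1 → (d - d % 2) + sTOfRecord d + laLowOfRecord d + 1 = sTOfRecord d + (d - d % 2) + 2 * (d % 2)) := by
  have hms : mstarOfRecord d = d % 2 + 2 * d - 1 := rfl
  have hmc : mcOfRecord d = 2 * ((mstarOfRecord d + d) / 2) := rfl
  have hsT : sTOfRecord d = d - 1 + d % 2 := rfl
  have hla : laLowOfRecord d = d % 2 := rfl
  refine ⟨by omega, by omega, by omega, fun h => by omega, fun h => by omega⟩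

/-- **ROW T₊-hi = lev(ℓ₀+1, m_c)**: `(laHighOfRecord d, mcOfRecord d, sTOfRecord d + 1, (d − d%2) + (sTOfRecord d − 1))`. [cite: Rogawski1990, §4.9 Prop. 4.9.1 (b) p. 55] -/
theorem instanceLetters_levTHi (d : ℕ) (hd : 2 ≤ d) :
    laHighOfRecord d ≤ d ∧ d + 2 * laHighOfRecord d ≤ mcOfRecord d + 1 ∧
      2 * (sTOfRecord d + 1) + 2 * ((d + laHighOfRecord d % 2) / 2) = laHighOfRecord d + laHighOfRecord d % 2 + (mcOfRecord d + mcOfRecord d % 2) ∧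
      (laHighOfRecord d % 2 = 0 → (d - d % 2) + (sTOfRecord d - 1) + laHighOfRecord d = (sTOfRecord d + 1) + (d - d % 2)) ∧
      (laHighOfRecord d % 2 = 1 → (d - d % 2) + (sTOfRecord d - 1) + laHighOfRecord d + 1 = (sTOfRecord d + 1) + (d - d % 2) + 2 * (d % 2)) := by
  have hms : mstarOfRecord d = d % 2 + 2 * d - 1 := rfl
  have hmc : mcOfRecord d = 2 * ((mstarOfRecord d + d) / 2) := rfl
  have hsT : sTOfRecord d = d - 1 + d % 2 := rfl
  have hla : laHighOfRecord d = d % 2 + 1 := rfl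
  refine ⟨by omega, by omega, by omega, fun h => by omega, fun h => by omega⟩

end Summit.HodgeConjecture.HodgeConjecture.Cruxes.H413.F0P3cDyRamLevelsLawInstanceLetters
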